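import Summits.Ventures.PercRepro.S1CFCapsThree

/-!
# PercRepro — THE DEPENDENT `4`-SETS OF A LOOPLESS COLOOP-FREE MATROID OF NULLITY `4` ON `12` POINTS, STAGE 1 (p1, gen 37)

The cap `D₄` of p7's ν = 4 program, first stage. A dependent `4`-set contains a dependent pair, or contains a triangle, or
is a `4`-circuit: **`ncard_dep_four_le_split`** `D₄ ≤ 45 · D₂ + 9 · c₃ + c₄` (`ncard_with_member_le`: the `k`-sets containing
a member of a family of `j`-sets number `≤ C(|E| − j, k − j)` times the family). With the nullity-only circuit counts
`c₃ ≤ 20`, `c₄ ≤ 35` and `D₂ ≤ 6`: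
* **`ncard_dep_four_le_of_five_le`**: `D₂ ≥ 5` ⇒ `D₄ ≤ 201` — no short circuits (LEMMA K) and every dependent pair lies in
  one class `F` of `4` points (`closure_singleton_of_five_dep_pairs`), so the dependent `4`-sets are those meeting `F` in
  `≥ 2` points: `C(4, 2)·C(8, 2) + C(4, 3)·C(8, 1) + C(4, 4) = 168 + 32 + 1` — the value of the extremal `N`;
* **`ncard_dep_four_le_of_eq_four`**: `D₂ = 4` ⇒ `D₄ ≤ 180`;
* **`ncard_dep_four_le_of_le_three`**: `D₂ ≤ 3` ⇒ `D₄ ≤ 350` (stage 1; sharpened in the next modules);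
* **`ncard_dep_four_le_threefifty`**: `D₄ ≤ 350` unconditionally, and the `eRk ≤ 3` form **`ncard_four_eRk_le_three_le`**.
Nothing about any cell is claimed. Axioms: standard.
-/

open scoped Matroid

namespace PercRepro

namespace S1CF

open Set

variable {α : Type}

/-- **The `k`-subsets of `E` containing a member of a family `𝒞` of `j`-subsets of `E` number at most
`C(|E| − j, k − j) · #𝒞`.** -/
theorem ncard_with_member_le {E : Set α} (hE : E.Finite) (𝒞 : Set (Set α)) (j k : ℕ)
    (h𝒞 : ∀ T ∈ 𝒞, T ⊆ E ∧ T.ncard = j) :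
    {X : Set α | X ⊆ E ∧ X.ncard = k ∧ ∃ T ∈ 𝒞, T ⊆ X}.ncard ≤ (E.ncard - j).choose (k - j) * 𝒞.ncard := by
  classical
  have h𝒞fin : 𝒞.Finite := hE.finite_subsets.subset (fun T hT => (h𝒞 T hT).1)
  set Cf : Finset (Set α) := h𝒞fin.toFinset with hCf
  have hTfin : ∀ P : Set α, {X : Set α | X ⊆ E ∧ X.ncard = k ∧ P ⊆ X}.Finite :=
    fun _ => hE.finite_subsets.subset (fun _ hX => hX.1)
  set T : Set α → Finset (Set α) := fun P => (hTfin P).toFinset with hT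
  have hsub : {X : Set α | X ⊆ E ∧ X.ncard = k ∧ ∃ T ∈ 𝒞, T ⊆ X} ⊆
      ((Cf.biUnion T : Finset (Set α)) : Set (Set α)) := by
    intro X hX
    obtain ⟨hXE, hXk, P, hP𝒞, hPX⟩ := hX
    rw [Finset.coe_biUnion]
    refine Set.mem_iUnion₂.2 ⟨P, ?_, ?_⟩
    · rw [Finset.mem_coe, hCf, Set.Finite.mem_toFinset]
      exact hP𝒞
    · rw [hT]
      simp only [Set.Finite.coe_toFinset, Set.mem_setOf_eq]
      exact ⟨hXE, hXk, hPX⟩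
  have hbound : ∀ P ∈ Cf, (T P).card ≤ (E.ncard - j).choose (k - j) := by
    intro P hP
    rw [hCf, Set.Finite.mem_toFinset] at hP
    obtain ⟨hPE, hPj⟩ := h𝒞 P hP
    rw [hT]
    simp only
    rw [← Set.ncard_coe_finset, Set.Finite.coe_toFinset]
    have := ncard_supersets_le (P := P) hE k
    have hcard : (E \ P).ncard = E.ncard - j := by
      have := Set.ncard_sdiff_add_ncard_of_subset hPE hE
      omega
    rw [hcard, hPj] at this
    exact this
  calc {X : Set α | X ⊆ E ∧ X.ncard = k ∧ ∃ T ∈ 𝒞, T ⊆ X}.ncard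
      ≤ ((Cf.biUnion T : Finset (Set α)) : Set (Set α)).ncard :=
        Set.ncard_le_ncard hsub (Finset.finite_toSet _)
    _ = (Cf.biUnion T).card := Set.ncard_coe_finset _
    _ ≤ Cf.card * (E.ncard - j).choose (k - j) := Finset.card_biUnion_le_card_mul _ _ _ hbound
    _ = (E.ncard - j).choose (k - j) * 𝒞.ncard := by
        rw [mul_comm, hCf, ← Set.ncard_coe_finset, Set.Finite.coe_toFinset]

/-- A dependent `4`-set with no dependent pair and no triangle inside is a circuit (loopless matroid). -/
theorem isCircuit_of_dep_four_of_no_dep_pair_of_no_triangle (M : Matroid α) [M.Finite] {X : Set α}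
    (hX : X ⊆ M.E) (hX4 : X.ncard = 4) (hdep : M.Dep X) (hno2 : ∀ P ⊆ X, P.ncard = 2 → ¬ M.Dep P)
    (hno3 : ∀ T ⊆ X, M.IsCircuit T → T.ncard = 3 → False) : M.IsCircuit X := by
  rw [Matroid.isCircuit_iff_dep_forall_sdiff_singleton_indep]
  refine ⟨hdep, fun e he => ?_⟩
  have hXfin : X.Finite := M.ground_finite.subset hX
  have h3 : (X \ {e}).ncard = 3 := by
    rw [Set.ncard_sdiff_singleton_of_mem he, hX4]
  have hsub : X \ {e} ⊆ M.E := sdiff_subset.trans hX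
  rw [← Matroid.not_dep_iff hsub]
  intro hdep'
  have hc := isCircuit_of_dep_three_of_no_dep_pair M hsub h3 hdep'
    (fun P hP hP2 => hno2 P (hP.trans sdiff_subset) hP2)
  exact hno3 _ sdiff_subset hc h3

/-- The `4`-circuits number at most `35` (the circuit count at nullity `4`). -/
theorem ncard_fourCircuits_le_thirtyfive (M : Matroid α) [M.Finite]
    (hd : M.E.encard = M.eRank + ((4 : ℕ) : ℕ∞)) :
    {C : Set α | C ⊆ M.E ∧ M.IsCircuit C ∧ C.ncard = 4}.ncard ≤ 35 := by
  have h := ncard_isCircuit_ncard_eq_le M (ν := 4) (k := 4) (by norm_num) (subset_refl M.E)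
    (ncard_ground_eq_eRk_toNat_add M hd).le
  norm_num at h
  exact h

/-- **`D₄ ≤ 45 · D₂ + 9 · c₃ + c₄`**: a dependent `4`-set contains a dependent pair, or a triangle, or is a `4`-circuit. -/
theorem ncard_dep_four_le_split (M : Matroid α) [M.Finite] (hn : M.E.ncard = 12) :
    {X : Set α | X ⊆ M.E ∧ X.ncard = 4 ∧ M.Dep X}.ncard ≤
      45 * {P : Set α | P ⊆ M.E ∧ P.ncard = 2 ∧ M.Dep P}.ncard +
        9 * {C : Set α | C ⊆ M.E ∧ M.IsCircuit C ∧ C.ncard = 3}.ncard +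
          {C : Set α | C ⊆ M.E ∧ M.IsCircuit C ∧ C.ncard = 4}.ncard := by
  classical
  have hEfin := M.ground_finite
  set A := {X : Set α | X ⊆ M.E ∧ X.ncard = 4 ∧ ∃ P ⊆ X, P.ncard = 2 ∧ M.Dep P} with hA
  set B := {X : Set α | X ⊆ M.E ∧ X.ncard = 4 ∧
    ∃ T ∈ {C : Set α | C ⊆ M.E ∧ M.IsCircuit C ∧ C.ncard = 3}, T ⊆ X} with hB
  set C4 := {C : Set α | C ⊆ M.E ∧ M.IsCircuit C ∧ C.ncard = 4} with hC4
  have hAfin : A.Finite := hEfin.finite_subsets.subset (fun X hX => hX.1)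
  have hBfin : B.Finite := hEfin.finite_subsets.subset (fun X hX => hX.1)
  have hCfin : C4.Finite := hEfin.finite_subsets.subset (fun X hX => hX.1)
  have hsplit : {X : Set α | X ⊆ M.E ∧ X.ncard = 4 ∧ M.Dep X} ⊆ A ∪ B ∪ C4 := by
    intro X hX
    obtain ⟨hXE, hX4, hXdep⟩ := hX
    by_cases h2 : ∃ P ⊆ X, P.ncard = 2 ∧ M.Dep P
    · exact Or.inl (Or.inl ⟨hXE, hX4, h2⟩)
    by_cases h3 : ∃ T ⊆ X, M.IsCircuit T ∧ T.ncard = 3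
    · obtain ⟨T, hTX, hTc, hT3⟩ := h3
      exact Or.inl (Or.inr ⟨hXE, hX4, T, ⟨hTX.trans hXE, hTc, hT3⟩, hTX⟩)
    push Not at h2 h3
    exact Or.inr ⟨hXE, isCircuit_of_dep_four_of_no_dep_pair_of_no_triangle M hXE hX4 hXdep h2
      (fun T hT hTc hT3 => h3 T hT hTc hT3), hX4⟩
  have hAle : A.ncard ≤ 45 * {P : Set α | P ⊆ M.E ∧ P.ncard = 2 ∧ M.Dep P}.ncard := by
    have := ncard_with_dep_pair_le M 4
    rw [hn] at this
    norm_num at this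
    exact this
  have hBle : B.ncard ≤ 9 * {C : Set α | C ⊆ M.E ∧ M.IsCircuit C ∧ C.ncard = 3}.ncard := by
    have := ncard_with_member_le hEfin {C : Set α | C ⊆ M.E ∧ M.IsCircuit C ∧ C.ncard = 3} 3 4
      (fun T hT => ⟨hT.1, hT.2.2⟩)
    rw [hn] at this
    norm_num at this
    exact this
  calc {X : Set α | X ⊆ M.E ∧ X.ncard = 4 ∧ M.Dep X}.ncard
      ≤ (A ∪ B ∪ C4).ncard := Set.ncard_le_ncard hsplit ((hAfin.union hBfin).union hCfin)
    _ ≤ (A ∪ B).ncard + C4.ncard := Set.ncard_union_le _ _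
    _ ≤ A.ncard + B.ncard + C4.ncard := by gcongr; exact Set.ncard_union_le _ _
    _ ≤ _ := by gcongr

/-- **With `5` dependent pairs they all lie in one class of `4` points** (the `D₂ ≥ 5` form of
`closure_singleton_of_six_dep_pairs`). -/
theorem closure_singleton_of_five_dep_pairs (M : Matroid α) [M.Finite] (hL : ∀ e ∈ M.E, ¬ M.IsLoop e)
    (hK : ∀ e, ¬ M.IsColoop e) (hd : M.E.encard = M.eRank + ((4 : ℕ) : ℕ∞)) (hn : M.E.ncard = 12)
    (h5 : 5 ≤ {P : Set α | P ⊆ M.E ∧ P.ncard = 2 ∧ M.Dep P}.ncard)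
    {x y : α} (hxy : x ≠ y) (hxE : x ∈ M.E) (hyE : y ∈ M.E) (hdep : M.Dep {x, y}) :
    (M.closure {x}).ncard = 4 ∧
      ∀ P, P ⊆ M.E → P.ncard = 2 → M.Dep P → P ⊆ M.closure {x} := by
  have hEfin := M.ground_finite
  have hF4 : (M.closure {x}).ncard ≤ 4 := ncard_closure_singleton_le_four M hK hd hn x
  have hle := ncard_dep_pairs_le_choose_add M hL hK hd hn hxy hxE hyE hdep
  have hF2 : 2 ≤ (M.closure {x}).ncard := by
    have : ({x, y} : Set α) ⊆ M.closure {x} := by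
      intro w hw; rcases hw with rfl | rfl
      · exact M.mem_closure_self w hxE
      · exact mem_closure_singleton_of_dep_pair M hxE (hL x hxE) hdep
    rw [← Set.ncard_pair hxy]
    exact Set.ncard_le_ncard this (hEfin.subset (M.closure_subset_ground _))
  have hFeq : (M.closure {x}).ncard = 4 := by
    have hb : ∀ f : ℕ, 2 ≤ f → f ≤ 4 → f ≠ 4 → f.choose 2 + (5 - f).choose 2 ≤ 4 := by
      intro f h2 h4 hne
      interval_cases f <;> simp_all
    by_contra hne
    have := hb _ hF2 hF4 hne
    omega
  refine ⟨hFeq, fun P hPE hP2 hPdep => ?_⟩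
  by_contra hPF
  have hout := ncard_dep_pairs_not_subset_closure_le M hL hK hd hn hxy hxE hyE hdep
  rw [hFeq] at hout
  have hmem : P ∈ {P : Set α | P ⊆ M.E ∧ P.ncard = 2 ∧ M.Dep P ∧ ¬ P ⊆ M.closure {x}} :=
    ⟨hPE, hP2, hPdep, hPF⟩
  have hpos : 0 < {P : Set α | P ⊆ M.E ∧ P.ncard = 2 ∧ M.Dep P ∧ ¬ P ⊆ M.closure {x}}.ncard := by
    rw [Set.ncard_pos (hEfin.finite_subsets.subset (fun P hP => hP.1))]
    exact ⟨P, hmem⟩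
  norm_num at hout
  omega

/-- **`D₂ ≥ 5 ⇒ D₄ ≤ 201`**: the dependent `4`-sets are those meeting the class of `4` in at least two points. -/
theorem ncard_dep_four_le_of_five_le (M : Matroid α) [M.Finite] (hL : ∀ e ∈ M.E, ¬ M.IsLoop e)
    (hK : ∀ e, ¬ M.IsColoop e) (hd : M.E.encard = M.eRank + ((4 : ℕ) : ℕ∞)) (hn : M.E.ncard = 12)
    (h5 : 5 ≤ {P : Set α | P ⊆ M.E ∧ P.ncard = 2 ∧ M.Dep P}.ncard) :
    {X : Set α | X ⊆ M.E ∧ X.ncard = 4 ∧ M.Dep X}.ncard ≤ 201 := by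
  classical
  have hEfin := M.ground_finite
  obtain ⟨P₀, hP₀⟩ : {P : Set α | P ⊆ M.E ∧ P.ncard = 2 ∧ M.Dep P}.Nonempty := by
    rw [← Set.ncard_pos (hEfin.finite_subsets.subset (fun P hP => hP.1))]; omega
  obtain ⟨hP₀E, hP₀2, hP₀dep⟩ := hP₀
  obtain ⟨x, y, hxy, rfl⟩ := Set.ncard_eq_two.1 hP₀2
  have hxE : x ∈ M.E := hP₀E (by simp)
  have hyE : y ∈ M.E := hP₀E (by simp)
  obtain ⟨hF4, hall⟩ := closure_singleton_of_five_dep_pairs M hL hK hd hn h5 hxy hxE hyE hP₀dep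
  set F := M.closure {x} with hFdef
  have hF : F ⊆ M.E := M.closure_subset_ground _
  have hEF : (M.E \ F).ncard = 8 := by
    have := Set.ncard_sdiff_add_ncard_of_subset hF hEfin
    omega
  -- every dependent 4-set contains a dependent pair (no short circuits), which lies in `F`
  have hsub : {X : Set α | X ⊆ M.E ∧ X.ncard = 4 ∧ M.Dep X} ⊆
      {X : Set α | X ⊆ M.E ∧ X.ncard = 4 ∧ (X ∩ F).ncard = 2} ∪
        {X : Set α | X ⊆ M.E ∧ X.ncard = 4 ∧ (X ∩ F).ncard = 3} ∪
          {X : Set α | X ⊆ M.E ∧ X.ncard = 4 ∧ (X ∩ F).ncard = 4} := by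
    intro X hX
    obtain ⟨hXE, hX4, hXdep⟩ := hX
    have hXfin : X.Finite := hEfin.subset hXE
    have hpair : ∃ P ⊆ X, P.ncard = 2 ∧ M.Dep P := by
      by_contra h2
      push Not at h2
      have hno3 : ∀ T ⊆ X, M.IsCircuit T → T.ncard = 3 → False := fun T _ hTc hT3 =>
        not_isCircuit_of_four_le_ncard_dep_pairs M hL hK hd hn (by omega) hTc (by omega) (by omega)
      have hc := isCircuit_of_dep_four_of_no_dep_pair_of_no_triangle M hXE hX4 hXdep h2 hno3
      exact not_isCircuit_of_four_le_ncard_dep_pairs M hL hK hd hn (by omega) hc (by omega) (by omega)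
    obtain ⟨P, hPX, hP2, hPdep⟩ := hpair
    have hPF : P ⊆ F := hall P (hPX.trans hXE) hP2 hPdep
    have h2 : 2 ≤ (X ∩ F).ncard := by
      rw [← hP2]; exact Set.ncard_le_ncard (subset_inter hPX hPF) (hXfin.subset inter_subset_left)
    have h4 : (X ∩ F).ncard ≤ 4 := by
      rw [← hX4]; exact Set.ncard_le_ncard inter_subset_left hXfin
    rcases Nat.lt_or_ge (X ∩ F).ncard 3 with hlt | hge
    · exact Or.inl (Or.inl ⟨hXE, hX4, by omega⟩)
    rcases Nat.lt_or_ge (X ∩ F).ncard 4 with hlt' | hge'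
    · exact Or.inl (Or.inr ⟨hXE, hX4, by omega⟩)
    · exact Or.inr ⟨hXE, hX4, by omega⟩
  have hc2 := ncard_inter_eq_le hEfin hF 4 2
  have hc3 := ncard_inter_eq_le hEfin hF 4 3
  have hc4 := ncard_inter_eq_le hEfin hF 4 4
  rw [hF4, hEF] at hc2 hc3 hc4
  norm_num at hc2 hc3 hc4
  have e168 : Nat.choose 4 2 * Nat.choose 8 2 = 168 := by decide
  rw [e168] at hc2
  have hfin : ∀ i, {X : Set α | X ⊆ M.E ∧ X.ncard = 4 ∧ (X ∩ F).ncard = i}.Finite :=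
    fun _ => hEfin.finite_subsets.subset (fun X hX => hX.1)
  calc {X : Set α | X ⊆ M.E ∧ X.ncard = 4 ∧ M.Dep X}.ncard
      ≤ ({X : Set α | X ⊆ M.E ∧ X.ncard = 4 ∧ (X ∩ F).ncard = 2} ∪
          {X : Set α | X ⊆ M.E ∧ X.ncard = 4 ∧ (X ∩ F).ncard = 3} ∪
            {X : Set α | X ⊆ M.E ∧ X.ncard = 4 ∧ (X ∩ F).ncard = 4}).ncard :=
        Set.ncard_le_ncard hsub (((hfin 2).union (hfin 3)).union (hfin 4))
    _ ≤ ({X : Set α | X ⊆ M.E ∧ X.ncard = 4 ∧ (X ∩ F).ncard = 2} ∪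
          {X : Set α | X ⊆ M.E ∧ X.ncard = 4 ∧ (X ∩ F).ncard = 3}).ncard +
            {X : Set α | X ⊆ M.E ∧ X.ncard = 4 ∧ (X ∩ F).ncard = 4}.ncard := Set.ncard_union_le _ _
    _ ≤ {X : Set α | X ⊆ M.E ∧ X.ncard = 4 ∧ (X ∩ F).ncard = 2}.ncard +
          {X : Set α | X ⊆ M.E ∧ X.ncard = 4 ∧ (X ∩ F).ncard = 3}.ncard +
            {X : Set α | X ⊆ M.E ∧ X.ncard = 4 ∧ (X ∩ F).ncard = 4}.ncard := by
        gcongr; exact Set.ncard_union_le _ _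
    _ ≤ 168 + 32 + 1 := by gcongr
    _ = 201 := by norm_num

/-- **`D₂ = 4 ⇒ D₄ ≤ 180`** (no short circuits). -/
theorem ncard_dep_four_le_of_eq_four (M : Matroid α) [M.Finite] (hL : ∀ e ∈ M.E, ¬ M.IsLoop e)
    (hK : ∀ e, ¬ M.IsColoop e) (hd : M.E.encard = M.eRank + ((4 : ℕ) : ℕ∞)) (hn : M.E.ncard = 12)
    (h4 : {P : Set α | P ⊆ M.E ∧ P.ncard = 2 ∧ M.Dep P}.ncard = 4) :
    {X : Set α | X ⊆ M.E ∧ X.ncard = 4 ∧ M.Dep X}.ncard ≤ 180 := by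
  have hEfin := M.ground_finite
  have hsplit := ncard_dep_four_le_split M hn
  have hT0 : {C : Set α | C ⊆ M.E ∧ M.IsCircuit C ∧ C.ncard = 3}.ncard = 0 := by
    rw [Set.ncard_eq_zero (hEfin.finite_subsets.subset (fun X hX => hX.1)),
      Set.eq_empty_iff_forall_notMem]
    intro C hC
    obtain ⟨-, hCc, hC3⟩ := hC
    exact not_isCircuit_of_four_le_ncard_dep_pairs M hL hK hd hn (by omega) hCc (by omega) (by omega)
  have hC0 : {C : Set α | C ⊆ M.E ∧ M.IsCircuit C ∧ C.ncard = 4}.ncard = 0 := by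
    rw [Set.ncard_eq_zero (hEfin.finite_subsets.subset (fun X hX => hX.1)),
      Set.eq_empty_iff_forall_notMem]
    intro C hC
    obtain ⟨-, hCc, hC4⟩ := hC
    exact not_isCircuit_of_four_le_ncard_dep_pairs M hL hK hd hn (by omega) hCc (by omega) (by omega)
  rw [h4, hT0, hC0] at hsplit
  omega

/-- **`D₂ ≤ 3 ⇒ D₄ ≤ 350`** (stage 1: the nullity-only circuit counts). -/
theorem ncard_dep_four_le_of_le_three (M : Matroid α) [M.Finite]
    (hd : M.E.encard = M.eRank + ((4 : ℕ) : ℕ∞)) (hn : M.E.ncard = 12)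
    (h3 : {P : Set α | P ⊆ M.E ∧ P.ncard = 2 ∧ M.Dep P}.ncard ≤ 3) :
    {X : Set α | X ⊆ M.E ∧ X.ncard = 4 ∧ M.Dep X}.ncard ≤ 350 := by
  have hsplit := ncard_dep_four_le_split M hn
  have hT := ncard_triangles_le_twenty M hd
  have hC := ncard_fourCircuits_le_thirtyfive M hd
  omega

/-- **`D₄ ≤ 350`** (stage 1, unconditional). -/
theorem ncard_dep_four_le_threefifty (M : Matroid α) [M.Finite] (hL : ∀ e ∈ M.E, ¬ M.IsLoop e)
    (hK : ∀ e, ¬ M.IsColoop e) (hd : M.E.encard = M.eRank + ((4 : ℕ) : ℕ∞)) (hn : M.E.ncard = 12) :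
    {X : Set α | X ⊆ M.E ∧ X.ncard = 4 ∧ M.Dep X}.ncard ≤ 350 := by
  rcases Nat.lt_or_ge {P : Set α | P ⊆ M.E ∧ P.ncard = 2 ∧ M.Dep P}.ncard 4 with hlt | hge
  · exact ncard_dep_four_le_of_le_three M hd hn (by omega)
  rcases Nat.lt_or_ge {P : Set α | P ⊆ M.E ∧ P.ncard = 2 ∧ M.Dep P}.ncard 5 with hlt' | hge'
  · exact (ncard_dep_four_le_of_eq_four M hL hK hd hn (by omega)).trans (by norm_num)
  · exact (ncard_dep_four_le_of_five_le M hL hK hd hn hge').trans (by norm_num)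

/-- **`D₄ ≤ 201` whenever `D₂ ≥ 4`**. -/
theorem ncard_dep_four_le_of_four_le (M : Matroid α) [M.Finite] (hL : ∀ e ∈ M.E, ¬ M.IsLoop e)
    (hK : ∀ e, ¬ M.IsColoop e) (hd : M.E.encard = M.eRank + ((4 : ℕ) : ℕ∞)) (hn : M.E.ncard = 12)
    (h4 : 4 ≤ {P : Set α | P ⊆ M.E ∧ P.ncard = 2 ∧ M.Dep P}.ncard) :
    {X : Set α | X ⊆ M.E ∧ X.ncard = 4 ∧ M.Dep X}.ncard ≤ 201 := by
  rcases Nat.lt_or_ge {P : Set α | P ⊆ M.E ∧ P.ncard = 2 ∧ M.Dep P}.ncard 5 with hlt | hge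
  · exact (ncard_dep_four_le_of_eq_four M hL hK hd hn (by omega)).trans (by norm_num)
  · exact ncard_dep_four_le_of_five_le M hL hK hd hn hge

/-- The `4`-sets of rank `≤ 3` are the dependent `4`-sets (rank form of the counts). -/
theorem four_eRk_le_three_subset_dep (M : Matroid α) [M.Finite] :
    {X : Set α | X ⊆ M.E ∧ X.ncard = 4 ∧ M.eRk X ≤ 3} ⊆ {X : Set α | X ⊆ M.E ∧ X.ncard = 4 ∧ M.Dep X} := by
  intro X hX
  obtain ⟨hXE, hX4, hXr⟩ := hX
  refine ⟨hXE, hX4, ?_⟩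
  have hXfin : X.Finite := M.ground_finite.subset hXE
  rw [← Matroid.eRk_lt_encard_iff_dep_of_finite hXfin hXE, ← hXfin.cast_ncard_eq, hX4]
  exact lt_of_le_of_lt hXr (by norm_num)

/-- **`D₄ ≤ 350`, rank form** (stage 1). -/
theorem ncard_four_eRk_le_three_le (M : Matroid α) [M.Finite] (hL : ∀ e ∈ M.E, ¬ M.IsLoop e)
    (hK : ∀ e, ¬ M.IsColoop e) (hd : M.E.encard = M.eRank + ((4 : ℕ) : ℕ∞)) (hn : M.E.ncard = 12) :
    {X : Set α | X ⊆ M.E ∧ X.ncard = 4 ∧ M.eRk X ≤ 3}.ncard ≤ 350 :=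
  (Set.ncard_le_ncard (four_eRk_le_three_subset_dep M)
    (M.ground_finite.finite_subsets.subset (fun _ hX => hX.1))).trans
    (ncard_dep_four_le_threefifty M hL hK hd hn)

end S1CF

end PercRepro
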